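import Summits.QuantumFields.YangMills.Theorems.FemtoCutoffLadderLocalWallTopPos
import HarnessLib

/-!
# Route `FemtoCutoffLadder`, LINE g5-A / LINE 2: the WALLED SECOND VALUE is positive — uniformly in the wall set

Seat `leafhand-qf-femtocutoffladder-1` g0 (2026-08-30), items `LargeFieldInsensitivityR` (stmt-QuantumFields-26197), its skeleton stub
`LocalWallStep` (26282; first rungs `SingleWallStep` 26631, `LastWallStep` 26638) and, through `SmallFieldOctaveStep` (25695), the crux
`OctaveStepDecay` (24153).  Every comparison clause of these items cross-multiplies `L`-th powers of a walled TOP value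
`t = sSup (rayleighSet su2Rep L β W)` and a walled SECOND value
`s = sInf_φ sSup (rayleighSet su2Rep L β (W ∧ · ⊥ φ))`, `W ψ := ∀ U, bad U → ψ U = 0`, where the «bad» event says that some plaquette
(of a wall set `Q`, or any plaquette) has deviation `2 − Re tr U_p` above the small-field threshold `c = β^{κ−1}`.  The companion file
`FemtoCutoffLadderLocalWallTopPos` (lead fcl-p1 g9, p615421) proved `0 < t` for every wall set; the sizing memo of fcl-p3 g8
(`Cruxes/SingleWallStep/SIZING-fcl-p3-g8.md`) records `0 < s` as the remaining structural fact («every 2-plane of V_Q has positive bottom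
Rayleigh value»).  This file proves it, with a floor that does NOT depend on the wall:

* §1 a two-link test configuration `U_θ` (direction-0 links `chartSU2 (θe₀)`, direction-1 links `chartSU2 (θe₁)`): every plaquette deviation
  of `U_θ` is at most that of the commutator, which is `4θ⁴` (`plaquetteDeviation_twoLinkCfg_le`, `re_trace_comm_chart`);
* §2 the smooth small-field bump `h_c(U) = ∏_p max 0 (c − (2 − Re tr U_p))` (continuous, gauge- and twist-invariant, vanishing as soon as
  ONE plaquette deviation reaches `c`, positive on `{∀ p, 2 − Re tr U_p < c}`): `h_c · ψ` is physical for physical `ψ` (`isPhys_sfBump_mul`);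
* §3 ★ `exists_pos_le_walledSecond`: for `β > 0`, `c > 0` there is `s₀ > 0` (depending on `L, β, c` only) with `s₀ ≤ s` for EVERY bad
  event implying `∃ p, c ≤ 2 − Re tr U_p` — the physical trial plane spanned by `h_c` and `h_c · plaqObs` (continuous, linearly independent:
  evaluate at `1` and at `U_θ`) carries a uniform Rayleigh floor (`exists_pos_mul_le_of_pos`, strict positivity `qform_su2Rep_pos`, full
  support of the a-priori measure), and rank–nullity (`exists_ne_zero_forall_l2_eq_zero`) supplies in it a non-zero function orthogonal to
  any given constraint `φ`;
* §4 the items' shapes verbatim: `walledSecond_pos` (wall set `Q`, threshold `β^{κ−1}`, as in 26282/26631/26638) and `smallFieldSecond_pos`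
  (all plaquettes, as in 26197/25695).

HONEST FRAMING: elementary fixed-lattice functional analysis; the comparison clauses (the content of the items, an open two-cutoff statement
behind `UVStabilityNonUniqueness`) are untouched.  R2b1 is a RECORD rung — not infinite volume, not a mass gap, not Clay; no summit is proved
by this file.  No definitions, no named facts, no `sorry`.
-/

set_option autoImplicit false

noncomputable section

open MeasureTheory Filter Topology Real
open Literature.MathematicalPhysics.QuantumFieldTheory
open Literature.MathematicalPhysics.QuantumLattice
open Literature.Analysis.OperatorTheory.YMMatrixModel

namespace Summit.QuantumFields.YangMills.Theorems.FemtoTransferGap.SFCompression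

open PhysL2

variable {L : ℕ} [NeZero L]

/-! ## §1 A two-link test configuration with small but non-trivial plaquettes -/

omit [NeZero L] in
/-- On a two-link configuration (`a` on every direction-`0` link, `b` on every direction-`1` link, `1` elsewhere) every plaquette deviation
is at most the deviation of the commutator `a b a⁻¹ b⁻¹` (the `(0,1)` plaquettes ARE the commutator, the others are trivial). [folklore] -/
theorem plaquetteDeviation_twoLinkCfg_le (a b : SU2) (p : Plaquette 3 L) :
    2 - (su2Rep (plaquetteHolonomy (twoLinkCfg (L := L) a b) p.1 p.2.1.1 p.2.1.2)).trace.re ≤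
      2 - (su2Rep (a * b * a⁻¹ * b⁻¹)).trace.re := by
  obtain ⟨x, ⟨⟨i, j⟩, hij⟩⟩ := p
  have hcomm : (su2Rep (a * b * a⁻¹ * b⁻¹)).trace.re ≤ 2 := by
    rw [fundamentalRep_apply, re_trace_eq_two_mul_scalarPart]
    have := abs_scalarPart_le (a * b * a⁻¹ * b⁻¹)
    rw [abs_le] at this
    linarith [this.2]
  have htwo : (su2Rep (1 : SU2)).trace.re = 2 := by
    rw [map_one, Matrix.trace_one]; simp
  fin_cases i <;> fin_cases j <;> simp_all [plaquetteHolonomy, twoLinkCfg]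
  all_goals exact absurd hij (by decide)

omit [NeZero L] in
/-- The commutator of `chartSU2 (θe₀)` and `chartSU2 (θe₁)` (`0 ≤ θ ≤ 1`) has `Re tr = 2(1 − 2θ⁴)` (scalar part `1 − 2|θe₀ × θe₁|²`).
[cite: Luscher1983, §2] -/
theorem re_trace_comm_chart {θ : ℝ} (hθ : θ ∈ Set.Icc (0 : ℝ) 1) :
    (su2Rep (chartSU2 (Pi.single 0 θ) * chartSU2 (Pi.single 1 θ) * (chartSU2 (Pi.single 0 θ))⁻¹ *
      (chartSU2 (Pi.single 1 θ))⁻¹)).trace.re = 2 * (1 - 2 * θ ^ 4) := by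
  have h2 : θ ^ 2 ≤ 1 := by nlinarith [hθ.1, hθ.2]
  have ha : ∑ c, (Pi.single (0 : Fin 3) θ : Fin 3 → ℝ) c ^ 2 ≤ 1 := by
    simpa [Fin.sum_univ_three] using h2
  have hb : ∑ c, (Pi.single (1 : Fin 3) θ : Fin 3 → ℝ) c ^ 2 ≤ 1 := by
    simpa [Fin.sum_univ_three] using h2
  rw [fundamentalRep_apply, re_trace_eq_two_mul_scalarPart, scalarPart_comm_eq, vecPart_chartSU2 ha, vecPart_chartSU2 hb]
  simp [cross_apply, dotProduct, Fin.sum_univ_three]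
  ring

omit [NeZero L] in
/-- `plaqObs` of that two-link configuration is `1 − 2θ⁴`. [folklore] -/
theorem plaqObs_twoLinkCfg_chart_chart {θ : ℝ} (hθ : θ ∈ Set.Icc (0 : ℝ) 1) :
    plaqObs L (twoLinkCfg (chartSU2 (Pi.single 0 θ)) (chartSU2 (Pi.single 1 θ))) = 1 - 2 * θ ^ 4 := by
  have h := re_trace_comm_chart hθ
  rw [fundamentalRep_apply, re_trace_eq_two_mul_scalarPart] at h
  rw [plaqObs, plaquetteHolonomy_twoLinkCfg]
  linarith

/-! ## §2 The smooth small-field bump -/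

/-- The bump `h_c(U) = ∏_p max 0 (c − (2 − Re tr U_p))` is continuous. [folklore] -/
theorem continuous_sfBump (c : ℝ) :
    Continuous fun U : GaugeConfig 3 L SU2 =>
      ∏ p : Plaquette 3 L, max 0 (c - (2 - (su2Rep (plaquetteHolonomy U p.1 p.2.1.1 p.2.1.2)).trace.re)) :=
  continuous_finsetProd _ fun p _ => continuous_const.max (continuous_const.sub (continuous_plaquetteDeviation p))

/-- The bump is non-negative. [folklore] -/
theorem sfBump_nonneg (c : ℝ) (U : GaugeConfig 3 L SU2) :
    0 ≤ ∏ p : Plaquette 3 L, max 0 (c - (2 - (su2Rep (plaquetteHolonomy U p.1 p.2.1.1 p.2.1.2)).trace.re)) :=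
  Finset.prod_nonneg fun _ _ => le_max_left _ _

/-- The bump vanishes as soon as one plaquette deviation reaches the threshold. [folklore] -/
theorem sfBump_eq_zero_of_le {c : ℝ} {U : GaugeConfig 3 L SU2} {p : Plaquette 3 L}
    (hp : c ≤ 2 - (su2Rep (plaquetteHolonomy U p.1 p.2.1.1 p.2.1.2)).trace.re) :
    ∏ q : Plaquette 3 L, max 0 (c - (2 - (su2Rep (plaquetteHolonomy U q.1 q.2.1.1 q.2.1.2)).trace.re)) = 0 :=
  Finset.prod_eq_zero (Finset.mem_univ p) (max_eq_left (by linarith))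

/-- The bump is positive where every plaquette deviation is below the threshold. [folklore] -/
theorem sfBump_pos_of_lt {c : ℝ} {U : GaugeConfig 3 L SU2}
    (hU : ∀ p : Plaquette 3 L, 2 - (su2Rep (plaquetteHolonomy U p.1 p.2.1.1 p.2.1.2)).trace.re < c) :
    0 < ∏ q : Plaquette 3 L, max 0 (c - (2 - (su2Rep (plaquetteHolonomy U q.1 q.2.1.1 q.2.1.2)).trace.re)) :=
  Finset.prod_pos fun q _ => lt_max_iff.2 (Or.inr (by linarith [hU q]))

/-- The bump is gauge invariant (the holonomy is conjugated, the trace is a class function). [folklore] -/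
theorem sfBump_gaugeTransform (c : ℝ) (g : Site 3 L → SU2) (U : GaugeConfig 3 L SU2) :
    (∏ p : Plaquette 3 L, max 0 (c - (2 - (su2Rep (plaquetteHolonomy (gaugeTransform g U) p.1 p.2.1.1 p.2.1.2)).trace.re))) =
      ∏ p : Plaquette 3 L, max 0 (c - (2 - (su2Rep (plaquetteHolonomy U p.1 p.2.1.1 p.2.1.2)).trace.re)) :=
  Finset.prod_congr rfl fun p _ => by
    rw [Literature.MathematicalPhysics.QuantumLattice.plaquetteHolonomy_gaugeTransform, trace_su2Rep_conj]

/-- The bump is invariant under central twists (they do not move plaquette holonomies). [folklore] -/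
theorem sfBump_twist (c : ℝ) (k : Fin 3) {z : SU2} (hz : z ∈ Subgroup.center SU2) (U : GaugeConfig 3 L SU2) :
    (∏ p : Plaquette 3 L, max 0 (c - (2 - (su2Rep (plaquetteHolonomy (twist k z U) p.1 p.2.1.1 p.2.1.2)).trace.re))) =
      ∏ p : Plaquette 3 L, max 0 (c - (2 - (su2Rep (plaquetteHolonomy U p.1 p.2.1.1 p.2.1.2)).trace.re)) :=
  Finset.prod_congr rfl fun p _ => by
    rw [plaquetteHolonomy_twist_of_mem_center k hz U p.1 (ne_of_lt p.2.2)]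

/-- **`h_c · ψ` is physical for physical `ψ`** (bounded: continuity on the compact configuration space). [folklore] -/
theorem isPhys_sfBump_mul (c : ℝ) {ψ : GaugeConfig 3 L SU2 → ℝ} (hψ : IsPhys ψ) :
    IsPhys fun U : GaugeConfig 3 L SU2 =>
      (∏ p : Plaquette 3 L, max 0 (c - (2 - (su2Rep (plaquetteHolonomy U p.1 p.2.1.1 p.2.1.2)).trace.re))) * ψ U := by
  have hcont := continuous_sfBump (L := L) c
  obtain ⟨C, hC⟩ := (isCompact_range (continuous_abs.comp hcont)).bddAbove
  have hb : ∀ U : GaugeConfig 3 L SU2,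
      |∏ p : Plaquette 3 L, max 0 (c - (2 - (su2Rep (plaquetteHolonomy U p.1 p.2.1.1 p.2.1.2)).trace.re))| ≤ C :=
    fun U => hC ⟨U, rfl⟩
  exact hψ.mul_of_invariant hcont.measurable hb (sfBump_gaugeTransform c) (fun k z hz U => sfBump_twist c k hz U)

/-! ## §3 ★ A wall-independent floor under the walled second value -/

/-- **The walled second value has a positive floor, uniformly in the wall.**  For `β > 0` and a threshold `c > 0` there is `s₀ > 0` such
that for EVERY «bad» event implying that some plaquette deviation is at least `c`,
`s₀ ≤ sInf_φ sSup (rayleighSet su2Rep L β (fun ψ => (∀ U, bad U → ψ U = 0) ∧ l2 ψ φ = 0))`.  Proof: the plane spanned by `h_c` and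
`h_c·plaqObs` consists of admissible physical test functions, is two-dimensional with `‖·‖²` definite (continuity, full support, evaluation at
`1` and at a two-link configuration) and `⟨·,K_β·⟩` strictly positive (`qform_su2Rep_pos`), so it has a uniform Rayleigh floor
(`exists_pos_mul_le_of_pos`); for each constraint `φ` rank–nullity gives a non-zero element orthogonal to `φ`.
[cite: Luscher1977, §3] [cite: ReedSimonIV1978, Thm. XIII.1] -/
theorem exists_pos_le_walledSecond (L : ℕ) [NeZero L] {β : ℝ} (hβ : 0 < β) {c : ℝ} (hc : 0 < c) :
    ∃ s₀ : ℝ, 0 < s₀ ∧ ∀ bad : GaugeConfig 3 L SU2 → Prop,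
      (∀ U, bad U → ∃ p : Plaquette 3 L, c ≤ 2 - (su2Rep (plaquetteHolonomy U p.1 p.2.1.1 p.2.1.2)).trace.re) →
      s₀ ≤ sInf {x : ℝ | ∃ φ : GaugeConfig 3 L SU2 → ℝ, IsPhys φ ∧
        x = sSup (rayleighSet su2Rep L β fun ψ => (∀ U, bad U → ψ U = 0) ∧ l2 ψ φ = 0)} := by
  classical
  -- the bump and the two trial functions
  set h : GaugeConfig 3 L SU2 → ℝ := fun U =>
    ∏ p : Plaquette 3 L, max 0 (c - (2 - (su2Rep (plaquetteHolonomy U p.1 p.2.1.1 p.2.1.2)).trace.re)) with hh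
  have hcont : Continuous h := continuous_sfBump c
  have hphys : ∀ n : ℕ, IsPhys fun U : GaugeConfig 3 L SU2 => h U * plaqObs L U ^ n :=
    fun n => isPhys_sfBump_mul c (isPhys_plaqObs_pow n)
  set Φ : Fin 2 → physSubmodule L := fun i => ⟨fun U => h U * plaqObs L U ^ (i : ℕ), hphys i⟩ with hΦ
  -- combinations, as functions
  have hcoe : ∀ a : Fin 2 → ℝ, ((∑ i, a i • Φ i : physSubmodule L) : GaugeConfig 3 L SU2 → ℝ) =
      fun U => h U * (a 0 + a 1 * plaqObs L U) := by
    intro a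
    funext U
    rw [Submodule.coe_sum, Finset.sum_apply, Fin.sum_univ_two]
    simp [hΦ]
    ring
  have hcomb_cont : ∀ a : Fin 2 → ℝ, Continuous (((∑ i, a i • Φ i : physSubmodule L) : GaugeConfig 3 L SU2 → ℝ)) := by
    intro a
    rw [hcoe a]
    exact hcont.mul (continuous_const.add (continuous_const.mul continuous_plaqObs))
  -- the two evaluation points: the trivial configuration and a two-link configuration
  have hdev1 : ∀ p : Plaquette 3 L, 2 - (su2Rep (plaquetteHolonomy (1 : GaugeConfig 3 L SU2) p.1 p.2.1.1 p.2.1.2)).trace.re = 0 := by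
    intro p
    rw [plaquetteHolonomy_one, map_one, Matrix.trace_one]
    simp
  have h1 : h 1 = c ^ Fintype.card (Plaquette 3 L) := by
    simp only [hh, hdev1, sub_zero, max_eq_right hc.le]
    rw [Finset.prod_const, Finset.card_univ]
  have h1pos : 0 < h 1 := by rw [h1]; exact pow_pos hc _
  have hobs1 : plaqObs L (1 : GaugeConfig 3 L SU2) = 1 := by
    have h := re_trace_eq_two_mul_scalarPart (plaquetteHolonomy (1 : GaugeConfig 3 L SU2) 0 0 1)
    rw [plaquetteHolonomy_one] at h
    have h2 : (((1 : SU2) : Matrix (Fin 2) (Fin 2) ℂ).trace).re = 2 := by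
      rw [OneMemClass.coe_one, Matrix.trace_one]; simp
    rw [plaqObs, plaquetteHolonomy_one]
    linarith
  set θ : ℝ := min (1 / 2) (c / 8) with hθ
  have hθpos : 0 < θ := lt_min (by norm_num) (by linarith)
  have hθhalf : θ ≤ 1 / 2 := min_le_left _ _
  have hθc : θ ≤ c / 8 := min_le_right _ _
  have hθI : θ ∈ Set.Icc (0 : ℝ) 1 := ⟨hθpos.le, by linarith⟩
  have hθ4 : 4 * θ ^ 4 < c := by
    have : θ ^ 4 ≤ θ * (1 / 2) ^ 3 := by
      have : θ ^ 4 = θ * θ ^ 3 := by ring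
      rw [this]
      exact mul_le_mul_of_nonneg_left (pow_le_pow_left₀ hθpos.le hθhalf 3) hθpos.le
    nlinarith
  set Uθ : GaugeConfig 3 L SU2 := twoLinkCfg (chartSU2 (Pi.single 0 θ)) (chartSU2 (Pi.single 1 θ)) with hUθ
  have hdevθ : ∀ p : Plaquette 3 L, 2 - (su2Rep (plaquetteHolonomy Uθ p.1 p.2.1.1 p.2.1.2)).trace.re < c := by
    intro p
    have hle := plaquetteDeviation_twoLinkCfg_le (L := L) (chartSU2 (Pi.single 0 θ)) (chartSU2 (Pi.single 1 θ)) p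
    rw [re_trace_comm_chart hθI] at hle
    linarith
  have hθpos' : 0 < h Uθ := sfBump_pos_of_lt hdevθ
  have hobsθ : plaqObs L Uθ = 1 - 2 * θ ^ 4 := plaqObs_twoLinkCfg_chart_chart hθI
  -- a combination vanishing identically has zero coefficients
  have hzero : ∀ a : Fin 2 → ℝ, ((∑ i, a i • Φ i : physSubmodule L) : GaugeConfig 3 L SU2 → ℝ) = 0 → a = 0 := by
    intro a ha
    rw [hcoe a] at ha
    have e1 := congr_fun ha 1
    have e2 := congr_fun ha Uθ
    simp only [Pi.zero_apply, hobs1, hobsθ, mul_one] at e1 e2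
    have f1 : a 0 + a 1 = 0 := by
      rcases mul_eq_zero.1 e1 with h0 | h0
      · exact absurd h0 h1pos.ne'
      · exact h0
    have f2 : a 0 + a 1 * (1 - 2 * θ ^ 4) = 0 := by
      rcases mul_eq_zero.1 e2 with h0 | h0
      · exact absurd h0 hθpos'.ne'
      · exact h0
    have hθ4pos : 0 < θ ^ 4 := pow_pos hθpos 4
    have ha1 : a 1 = 0 := by nlinarith
    have ha0 : a 0 = 0 := by rw [ha1] at f1; simpa using f1
    funext i
    fin_cases i
    · exact ha0
    · exact ha1
  -- `‖·‖²` is definite on the plane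
  have hl2pos : ∀ a : Fin 2 → ℝ, a ≠ 0 →
      0 < l2 ((∑ i, a i • Φ i : physSubmodule L) : GaugeConfig 3 L SU2 → ℝ)
        ((∑ i, a i • Φ i : physSubmodule L) : GaugeConfig 3 L SU2 → ℝ) := by
    intro a ha
    have hne : toL2 (∑ i, a i • Φ i : physSubmodule L) ≠ 0 := fun h0 =>
      ha (hzero a (coe_eq_zero_of_toL2_eq_zero (hcomb_cont a) h0))
    rw [← norm_sq_toL2]
    exact pow_pos (norm_pos_iff.mpr hne) 2
  -- the two forms and the uniform floor
  set B : physSubmodule L →ₗ[ℝ] physSubmodule L →ₗ[ℝ] ℝ := l2Form L with hB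
  set Qf : physSubmodule L →ₗ[ℝ] physSubmodule L →ₗ[ℝ] ℝ := (l2Form L).compl₂ (transferOp β) with hQf
  have hQapply : ∀ v : physSubmodule L, Qf v v = qform su2Rep β (v : GaugeConfig 3 L SU2 → ℝ) v := fun v => by
    rw [hQf, LinearMap.compl₂_apply, l2Form_transferOp_right]
  have hBpos : ∀ a : Fin 2 → ℝ, a ≠ 0 → 0 < B (∑ i, a i • Φ i) (∑ i, a i • Φ i) := fun a ha => by
    rw [hB, l2Form_apply]; exact hl2pos a ha
  have hQpos : ∀ a : Fin 2 → ℝ, a ≠ 0 → 0 < Qf (∑ i, a i • Φ i) (∑ i, a i • Φ i) := fun a ha => by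
    rw [hQapply]
    exact qform_su2Rep_pos hβ (isPhys_coe _) (hl2pos a ha)
  obtain ⟨s₀, hs₀, hfloor⟩ := exists_pos_mul_le_of_pos B Qf Φ hBpos hQpos
  -- the plane as a submodule of functions
  set W : Submodule ℝ (GaugeConfig 3 L SU2 → ℝ) :=
    Submodule.span ℝ (Set.range fun i => ((Φ i : physSubmodule L) : GaugeConfig 3 L SU2 → ℝ)) with hW
  have hli : LinearIndependent ℝ fun i => ((Φ i : physSubmodule L) : GaugeConfig 3 L SU2 → ℝ) := by
    rw [Fintype.linearIndependent_iff]
    intro a ha i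
    have ha' : ((∑ i, a i • Φ i : physSubmodule L) : GaugeConfig 3 L SU2 → ℝ) = 0 := by
      rw [Submodule.coe_sum]
      simpa only [Submodule.coe_smul] using ha
    exact congr_fun (hzero a ha') i
  have hrank : Module.finrank ℝ W = 2 := by
    rw [hW, finrank_span_eq_card hli, Fintype.card_fin]
  have hmem : ∀ ψ ∈ W, ∃ a : Fin 2 → ℝ, ψ = ((∑ i, a i • Φ i : physSubmodule L) : GaugeConfig 3 L SU2 → ℝ) := by
    intro ψ hψ
    obtain ⟨a, ha⟩ := Submodule.mem_span_range_iff_exists_fun ℝ |>.mp hψ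
    refine ⟨a, ?_⟩
    rw [← ha, Submodule.coe_sum]
    simp only [Submodule.coe_smul]
  have hadm : ∀ ψ ∈ W, IsPhys ψ := by
    intro ψ hψ
    obtain ⟨a, rfl⟩ := hmem ψ hψ
    exact isPhys_coe _
  refine ⟨s₀, hs₀, fun bad hbad => ?_⟩
  -- every element of the plane is admissible for every such wall
  have hwall : ∀ ψ ∈ W, ∀ U, bad U → ψ U = 0 := by
    intro ψ hψ U hU
    obtain ⟨a, rfl⟩ := hmem ψ hψ
    obtain ⟨p, hp⟩ := hbad U hU
    rw [hcoe a]
    show h U * (a 0 + a 1 * plaqObs L U) = 0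
    rw [show h U = 0 from sfBump_eq_zero_of_le hp, zero_mul]
  refine le_csInf (compressedSecondSet_nonempty β _) ?_
  rintro x ⟨φ, hφ, rfl⟩
  obtain ⟨ψ, hψW, hne, horth⟩ :=
    exists_ne_zero_forall_l2_eq_zero (lt_add_one 1) W hrank hadm (fun _ : Fin 1 => φ) fun _ => hφ
  obtain ⟨a, rfl⟩ := hmem ψ hψW
  have ha : a ≠ 0 := by
    rintro rfl
    apply hne
    simp
  have hpos : 0 < l2 ((∑ i, a i • Φ i : physSubmodule L) : GaugeConfig 3 L SU2 → ℝ)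
      ((∑ i, a i • Φ i : physSubmodule L) : GaugeConfig 3 L SU2 → ℝ) := hl2pos a ha
  have hfl : s₀ * l2 ((∑ i, a i • Φ i : physSubmodule L) : GaugeConfig 3 L SU2 → ℝ)
      ((∑ i, a i • Φ i : physSubmodule L) : GaugeConfig 3 L SU2 → ℝ) ≤
      qform su2Rep β ((∑ i, a i • Φ i : physSubmodule L) : GaugeConfig 3 L SU2 → ℝ)
        ((∑ i, a i • Φ i : physSubmodule L) : GaugeConfig 3 L SU2 → ℝ) := by
    have hf := hfloor a
    rw [hB, l2Form_apply, hQapply] at hf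
    exact hf
  have hmemR : qform su2Rep β ((∑ i, a i • Φ i : physSubmodule L) : GaugeConfig 3 L SU2 → ℝ)
        ((∑ i, a i • Φ i : physSubmodule L) : GaugeConfig 3 L SU2 → ℝ) /
      l2 ((∑ i, a i • Φ i : physSubmodule L) : GaugeConfig 3 L SU2 → ℝ)
        ((∑ i, a i • Φ i : physSubmodule L) : GaugeConfig 3 L SU2 → ℝ) ∈
      rayleighSet su2Rep L β (fun ψ => (∀ U, bad U → ψ U = 0) ∧ l2 ψ φ = 0) :=
    ⟨_, isPhys_coe _, ⟨hwall _ hψW, horth 0⟩, hpos, rfl⟩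
  exact ((le_div_iff₀ hpos).2 hfl).trans (le_csSup (bddAbove_rayleighSet_su2Rep L β _) hmemR)

/-! ## §4 The items' shapes -/

/-- ★ **The `Q`-walled second value is positive, for every wall set** (`β > 0`, any real `κ`, any `Q ⊆ Plaquette 3 L`) — the `s`-companion of
`walledTop_pos`; VERBATIM the `s Q` of `LocalWallStep` (stmt-QuantumFields-26282), `SingleWallStep` (26631), `LastWallStep` (26638); the floor
is uniform in `Q` (`exists_pos_le_walledSecond`). [cite: Luscher1977, §3] [cite: ReedSimonIV1978, Thm. XIII.1] -/
theorem walledSecond_pos (L : ℕ) [NeZero L] {β : ℝ} (hβ : 0 < β) (κ : ℝ) (Q : Set (Plaquette 3 L)) :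
    0 < sInf {x : ℝ | ∃ φ : GaugeConfig 3 L SU2 → ℝ, IsPhys φ ∧
      x = sSup (rayleighSet su2Rep L β fun ψ => (∀ U : GaugeConfig 3 L SU2,
        (∃ p ∈ Q, β ^ (κ - 1) < 2 - (su2Rep (plaquetteHolonomy U p.1 p.2.1.1 p.2.1.2)).trace.re) → ψ U = 0) ∧ l2 ψ φ = 0)} := by
  obtain ⟨s₀, hs₀, hle⟩ := exists_pos_le_walledSecond L hβ (Real.rpow_pos_of_pos hβ (κ - 1))
  refine hs₀.trans_le (hle (fun U => ∃ p ∈ Q, β ^ (κ - 1) < 2 - (su2Rep (plaquetteHolonomy U p.1 p.2.1.1 p.2.1.2)).trace.re) ?_)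
  rintro U ⟨p, -, hp⟩
  exact ⟨p, hp.le⟩

/-- **Uniform version**: one floor `s₀(L, β, κ) > 0` below the `Q`-walled second values of ALL wall sets `Q`. [cite: ReedSimonIV1978, Thm. XIII.1] -/
theorem exists_pos_forall_le_walledSecond (L : ℕ) [NeZero L] {β : ℝ} (hβ : 0 < β) (κ : ℝ) :
    ∃ s₀ : ℝ, 0 < s₀ ∧ ∀ Q : Set (Plaquette 3 L),
      s₀ ≤ sInf {x : ℝ | ∃ φ : GaugeConfig 3 L SU2 → ℝ, IsPhys φ ∧
        x = sSup (rayleighSet su2Rep L β fun ψ => (∀ U : GaugeConfig 3 L SU2,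
          (∃ p ∈ Q, β ^ (κ - 1) < 2 - (su2Rep (plaquetteHolonomy U p.1 p.2.1.1 p.2.1.2)).trace.re) → ψ U = 0) ∧ l2 ψ φ = 0)} := by
  obtain ⟨s₀, hs₀, hle⟩ := exists_pos_le_walledSecond L hβ (Real.rpow_pos_of_pos hβ (κ - 1))
  refine ⟨s₀, hs₀, fun Q => hle (fun U => ∃ p ∈ Q,
    β ^ (κ - 1) < 2 - (su2Rep (plaquetteHolonomy U p.1 p.2.1.1 p.2.1.2)).trace.re) ?_⟩
  rintro U ⟨p, -, hp⟩
  exact ⟨p, hp.le⟩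

/-- ★ **The SF-compressed second value `s_κ` is positive** — VERBATIM the `sInf` factor of `LargeFieldInsensitivityR` (stmt-QuantumFields-26197)
and of `SmallFieldOctaveStep` (25695): the hard small-field wall on ALL spatial plaquettes (`β > 0`, any real `κ`). [cite: Luscher1977, §3]
[cite: ReedSimonIV1978, Thm. XIII.1] -/
theorem smallFieldSecond_pos (L : ℕ) [NeZero L] {β : ℝ} (hβ : 0 < β) (κ : ℝ) :
    0 < sInf {x : ℝ | ∃ φ : GaugeConfig 3 L SU2 → ℝ, IsPhys φ ∧
      x = sSup (rayleighSet su2Rep L β fun ψ => (∀ U : GaugeConfig 3 L SU2,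
        (∃ p : Plaquette 3 L, β ^ (κ - 1) < 2 - (su2Rep (plaquetteHolonomy U p.1 p.2.1.1 p.2.1.2)).trace.re) → ψ U = 0) ∧
          l2 ψ φ = 0)} := by
  obtain ⟨s₀, hs₀, hle⟩ := exists_pos_le_walledSecond L hβ (Real.rpow_pos_of_pos hβ (κ - 1))
  refine hs₀.trans_le (hle (fun U => ∃ p : Plaquette 3 L,
    β ^ (κ - 1) < 2 - (su2Rep (plaquetteHolonomy U p.1 p.2.1.1 p.2.1.2)).trace.re) ?_)
  rintro U ⟨p, hp⟩
  exact ⟨p, hp.le⟩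

/-- On the femto window (`1 ≤ β`) the SF-compressed second value is positive. [folklore] -/
theorem smallFieldSecond_pos_of_window (L : ℕ) [NeZero L] {lam β : ℝ} (hw : InFemtoWindow lam β L) (κ : ℝ) :
    0 < sInf {x : ℝ | ∃ φ : GaugeConfig 3 L SU2 → ℝ, IsPhys φ ∧
      x = sSup (rayleighSet su2Rep L β fun ψ => (∀ U : GaugeConfig 3 L SU2,
        (∃ p : Plaquette 3 L, β ^ (κ - 1) < 2 - (su2Rep (plaquetteHolonomy U p.1 p.2.1.1 p.2.1.2)).trace.re) → ψ U = 0) ∧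
          l2 ψ φ = 0)} :=
  smallFieldSecond_pos L (zero_lt_one.trans_le hw.1) κ

/-! ## §5 Both sides of every comparison clause are positive (uniformly in the wall) -/

/-- **Uniform floor under the walled TOP values** `t Q`, all `Q` (`smallFieldTop_pos` + `sSup_rayleighSet_mono`). [cite: ReedSimonIV1978, Thm. XIII.1] -/
theorem exists_pos_forall_le_walledTop (L : ℕ) [NeZero L] {β : ℝ} (hβ : 0 < β) (κ : ℝ) :
    ∃ t₀ : ℝ, 0 < t₀ ∧ ∀ Q : Set (Plaquette 3 L),
      t₀ ≤ sSup (rayleighSet su2Rep L β fun ψ => ∀ U : GaugeConfig 3 L SU2,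
        (∃ p ∈ Q, β ^ (κ - 1) < 2 - (su2Rep (plaquetteHolonomy U p.1 p.2.1.1 p.2.1.2)).trace.re) → ψ U = 0) := by
  refine ⟨_, smallFieldTop_pos L hβ κ, fun Q => sSup_rayleighSet_mono hβ.le fun ψ hψ U hU => hψ U ?_⟩
  obtain ⟨p, -, hp⟩ := hU; exact ⟨p, hp⟩

/-- **Every cross product `s Q ^ n · t Q' ^ n` of the wall items is positive** (`β > 0`; any `Q, Q'`), so the comparison clauses of
`LocalWallStep` / `SingleWallStep` / `LastWallStep` compare positive reals and may be read additively (`wallComparisons_iff_abs_le`). [folklore] -/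
theorem walledSecond_pow_mul_walledTop_pow_pos (L : ℕ) [NeZero L] {β : ℝ} (hβ : 0 < β) (κ : ℝ) (Q Q' : Set (Plaquette 3 L)) (n : ℕ) :
    0 < sInf {x : ℝ | ∃ φ : GaugeConfig 3 L SU2 → ℝ, IsPhys φ ∧
        x = sSup (rayleighSet su2Rep L β fun ψ => (∀ U : GaugeConfig 3 L SU2,
          (∃ p ∈ Q, β ^ (κ - 1) < 2 - (su2Rep (plaquetteHolonomy U p.1 p.2.1.1 p.2.1.2)).trace.re) → ψ U = 0) ∧ l2 ψ φ = 0)} ^ n *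
      sSup (rayleighSet su2Rep L β fun ψ => ∀ U : GaugeConfig 3 L SU2,
        (∃ p ∈ Q', β ^ (κ - 1) < 2 - (su2Rep (plaquetteHolonomy U p.1 p.2.1.1 p.2.1.2)).trace.re) → ψ U = 0) ^ n :=
  mul_pos (pow_pos (walledSecond_pos L hβ κ Q) n) (pow_pos (walledTop_pos L hβ κ Q') n)

/-! ## §6 The additive reading of a pair of comparison clauses -/

/-- **Cross-multiplied comparison clauses ⟺ `|z − z'| ≤ a`** (`z = n·log(t/s)`), for positive `s, t, s', t'`:
`(s'^n t^n ≤ e^a s^n t'^n ∧ s^n t'^n ≤ e^a s'^n t^n) ↔ |n(log t − log s) − n(log t' − log s')| ≤ a`. [folklore] -/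
theorem wallComparisons_iff_abs_le {s t s' t' a : ℝ} (hs : 0 < s) (ht : 0 < t) (hs' : 0 < s') (ht' : 0 < t') (n : ℕ) :
    (s' ^ n * t ^ n ≤ Real.exp a * (s ^ n * t' ^ n) ∧ s ^ n * t' ^ n ≤ Real.exp a * (s' ^ n * t ^ n)) ↔
      |(n : ℝ) * (Real.log t - Real.log s) - (n : ℝ) * (Real.log t' - Real.log s')| ≤ a := by
  have h1 : 0 < s' ^ n * t ^ n := mul_pos (pow_pos hs' n) (pow_pos ht n)
  have h2 : 0 < s ^ n * t' ^ n := mul_pos (pow_pos hs n) (pow_pos ht' n)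
  have hlog1 : Real.log (s' ^ n * t ^ n) = n * Real.log s' + n * Real.log t := by
    rw [Real.log_mul (pow_pos hs' n).ne' (pow_pos ht n).ne', Real.log_pow, Real.log_pow]
  have hlog2 : Real.log (s ^ n * t' ^ n) = n * Real.log s + n * Real.log t' := by
    rw [Real.log_mul (pow_pos hs n).ne' (pow_pos ht' n).ne', Real.log_pow, Real.log_pow]
  have key : ∀ {x y : ℝ}, 0 < x → 0 < y → (x ≤ Real.exp a * y ↔ Real.log x ≤ a + Real.log y) := by
    intro x y hx hy
    rw [← Real.log_le_log_iff hx (mul_pos (Real.exp_pos a) hy), Real.log_mul (Real.exp_pos a).ne' hy.ne', Real.log_exp]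
  rw [key h1 h2, key h2 h1, hlog1, hlog2, abs_le]
  constructor <;> rintro ⟨hA, hB⟩ <;> constructor <;> linarith

end Summit.QuantumFields.YangMills.Theorems.FemtoTransferGap.SFCompression

end
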